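import Summits.AnomalousDissipation.AnomalousDissipation.Theses.TwoAndHalfD
import Literature.Analysis.FluidPDE.TwoHalfSection
import Literature.Analysis.FluidPDE.LongTimeAverageNonneg

/-!
# O2 `stub_eventualLogStrain` — from "not sub-log" to an EVENTUAL LOGARITHMIC RATE of the planar strain
# (line `Sketch`, crux stmt-AnomalousDissipation-0206)

Registered tool stub (section O, the witness window) of the line `Sketch` (duhamel-release) for the crux
`Summit.AnomalousDissipation.AnomalousDissipation.Theses.TwoAndHalfD.TwohalfdThesis` (= X,
stmt-AnomalousDissipation-0206): the zeroth law inside the `x₃`-invariant (2½-D) class — one steady smooth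
solenoidal mean-zero `x₃`-invariant force `f` on `T³`, `ν_j → 0`, `x₃`-invariant global Leray–Hopf
solutions `u_j` with `ν`-uniformly bounded `limsup`-mean energy and `limsup`-mean dissipation `≥ ε > 0`.

O1 (`stub_planarSubLogNoGo`, taken here VERBATIM AS A HYPOTHESIS) says that for every X-witness
`(f, ν, u₀, u)` the `limsup`-mean strain `a_j := ⟨‖∇v_j‖₂⟩` of the planar section
`v_j(t) = π_E ∘ u_j(t) ∘ ι` is not sub-logarithmic: `¬ (a_j / log(1/ν_j) → 0)`, i.e.
`limsup_j a_j / log(1/ν_j) > 0`.  O2 upgrades this to the `liminf` form, an EVENTUAL RATE: there is `c > 0`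
with `c · log(1/ν_j) ≤ a_j` for all large `j`.

Proof (pure `Filter` plumbing).  `a_j ≥ 0` (`longTimeAvgSup_nonneg`, `Real.sqrt_nonneg`) and eventually
`0 < log(1/ν_j)` (`ν_j → 0`, `ν_j > 0`).  If no `c > 0` is an eventual lower bound of `a_j / log(1/ν_j)`,
then for every `n` frequently `a_j < log(1/ν_j)/(n+1) ∧ 0 < log(1/ν_j)`;
`Filter.extraction_forall_of_frequently` extracts a strictly increasing `φ` with this at every `n`, so
`a_{φ n} / log(1/ν_{φ n}) → 0` by squeezing against `1/(n+1)`.  But every hypothesis of X is pointwise in `j`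
(or a `j`-uniform bound, or `ν_j → 0`, which passes to subsequences), so `(f, ν ∘ φ, u₀ ∘ φ, u ∘ φ)` is
again an X-witness, and O1 forbids `a_{φ n} / log(1/ν_{φ n}) → 0`.

* `exists_pos_eventually_mul_le_of_forall_strictMono` — the real-sequence extraction: `a ≥ 0`, `b > 0`
  eventually, `a ∘ φ / b ∘ φ ↛ 0` along every strictly increasing `φ` ⇒ `∃ c > 0, ∀ᶠ j, c · b_j ≤ a_j`;
* `stub_eventualLogStrain` — the registered stub (last declaration).  Supports stmt-AnomalousDissipation-0206.

## Mathlib / Literature search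

`lean search 'extraction_forall_of_frequently'` (Mathlib `Filter.extraction_forall_of_frequently`; same use in
`Summits/…/Theorems/TwoAndHalfDTwohalfdThesisSobolevCondensateWitnessFar.lean`, whose
`exists_strictMono_tendsto_zero_of_not_eventually_le` needs a pointwise-nonnegative sequence and a heavy
import, so the ratio form is proved here in 10 lines), `'Frequently.and_eventually'`,
`'tendsto_one_div_add_atTop_nhds_zero_nat'`, `'one_lt_inv₀'`, `'log_pos '`, `'longTimeAvgSup_nonneg'`
(`Literature/Analysis/FluidPDE/LongTimeAverageNonneg.lean`), `'def planarProjE|def planarSect|def eGradNormSq'`,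
`'stub_eventualLogStrain'` (only the skeleton), `'exists_pos_eventually_mul_le|of_forall_strictMono_not_tendsto'`
(no existing lemma of this shape); `lean find 'extraction_forall_of_frequently'` (prior stockroom: one
unrelated use), `'eventually_mul_le|not_tendsto_div|liminf_pos_of'` (nothing to adapt).
-/

noncomputable section

-- the summit path AnomalousDissipation/AnomalousDissipation duplicates a namespace component
set_option linter.dupNamespace false

namespace Summit.AnomalousDissipation.AnomalousDissipation.Theorems.TwohalfdThesis

open MeasureTheory Set Filter Topology
open scoped ENNReal NNReal
open Literature.Analysis.FunctionSpaces Literature.Analysis.FluidPDE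

/-! ### A real-sequence extraction -/

/-- **From "no subsequence of `a/b` tends to `0`" to an eventual linear lower bound.**  Let `a, b : ℕ → ℝ`
with `a ≥ 0` pointwise and `b > 0` eventually.  If along EVERY strictly increasing `φ : ℕ → ℕ` the ratio
`a (φ n) / b (φ n)` does not tend to `0`, then `c · b ≤ a` eventually for some `c > 0`.  (Otherwise for
every `n` frequently `a_j < b_j/(n+1) ∧ 0 < b_j`; extract `φ` by `Filter.extraction_forall_of_frequently`
and squeeze `0 ≤ a (φ n) / b (φ n) < 1/(n+1)`.) [folklore] -/
theorem exists_pos_eventually_mul_le_of_forall_strictMono {a b : ℕ → ℝ} (ha : ∀ j, 0 ≤ a j)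
    (hb : ∀ᶠ j in atTop, 0 < b j)
    (hsub : ∀ φ : ℕ → ℕ, StrictMono φ → ¬ Tendsto (fun n => a (φ n) / b (φ n)) atTop (𝓝 0)) :
    ∃ c : ℝ, 0 < c ∧ ∀ᶠ j in atTop, c * b j ≤ a j := by
  by_contra H
  have hfreq : ∀ n : ℕ, ∃ᶠ j in atTop, a j < 1 / ((n : ℝ) + 1) * b j ∧ 0 < b j := by
    intro n
    have h' : ¬ ∀ᶠ j in atTop, 1 / ((n : ℝ) + 1) * b j ≤ a j := fun hev =>
      H ⟨_, Nat.one_div_pos_of_nat, hev⟩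
    exact ((not_eventually.1 h').mono fun j hj => not_le.1 hj).and_eventually hb
  obtain ⟨φ, hφ, hφP⟩ := extraction_forall_of_frequently hfreq
  exact hsub φ hφ (squeeze_zero (fun n => div_nonneg (ha _) (hφP n).2.le)
    (fun n => ((div_lt_iff₀ (hφP n).2).2 (hφP n).1).le) tendsto_one_div_add_atTop_nhds_zero_nat)

/-! ### The registered stub -/

/-- **O2 `stub_eventualLogStrain` — from "not sub-log" to an EVENTUAL LOGARITHMIC RATE.**  `(O1, verbatim,
as a hypothesis) →` for every X-witness `(f, ν, u₀, u)` there is `c > 0` with `c·log(1/ν_j) ≤ ⟨‖∇v_j‖₂⟩`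
for all large `j`, `v_j(t) = π_E ∘ u_j(t) ∘ ι` the planar section.  The section strain mean is `≥ 0`
(`longTimeAvgSup_nonneg`), `log(1/ν_j) > 0` eventually (`ν_j → 0`), and a subsequence of an X-witness is
an X-witness (`hν0.comp hφ.tendsto_atTop`, the other clauses pointwise in `j`), so O1 applied to every
subsequence feeds `exists_pos_eventually_mul_le_of_forall_strictMono`. [folklore] -/
theorem stub_eventualLogStrain :
    (∀ f : UnitAddTorus (Fin 3) → EuclideanSpace ℝ (Fin 3),
      (∀ (s : UnitAddCircle) (x : UnitAddTorus (Fin 3)), f (x + Pi.single (2 : Fin 3) s) = f x) →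
      Torus.IsSmooth f → Torus.IsDivFree f → Torus.HasZeroMean f →
      ∀ (ν : ℕ → ℝ) (u₀ : ℕ → UnitAddTorus (Fin 3) → EuclideanSpace ℝ (Fin 3))
        (u : ℕ → ℝ → UnitAddTorus (Fin 3) → EuclideanSpace ℝ (Fin 3)),
        (∀ j, 0 < ν j) → Tendsto ν atTop (𝓝 0) →
        (∀ j, Torus.IsGlobalLerayHopf (ν j) (fun _ => f) (u₀ j) (u j)) →
        (∀ j (t : ℝ) (s : UnitAddCircle) (x : UnitAddTorus (Fin 3)),
          u j t (x + Pi.single (2 : Fin 3) s) = u j t x) →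
        (∃ E : ℝ, ∀ j, meanEnergy (u j) ≤ E) →
        (∃ ε : ℝ, 0 < ε ∧ ∀ j, ε ≤ meanDissipation (ν j) (u j)) →
        ¬ Tendsto (fun j => longTimeAvgSup (fun t => Real.sqrt (Torus.eGradNormSq
            (fun y : UnitAddTorus (Fin 2) => Torus.planarProjE (u j t (Torus.planarSect y)))).toReal) /
          Real.log (ν j)⁻¹) atTop (𝓝 0)) →
    ∀ f : UnitAddTorus (Fin 3) → EuclideanSpace ℝ (Fin 3),
      (∀ (s : UnitAddCircle) (x : UnitAddTorus (Fin 3)), f (x + Pi.single (2 : Fin 3) s) = f x) →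
      Torus.IsSmooth f → Torus.IsDivFree f → Torus.HasZeroMean f →
      ∀ (ν : ℕ → ℝ) (u₀ : ℕ → UnitAddTorus (Fin 3) → EuclideanSpace ℝ (Fin 3))
        (u : ℕ → ℝ → UnitAddTorus (Fin 3) → EuclideanSpace ℝ (Fin 3)),
        (∀ j, 0 < ν j) → Tendsto ν atTop (𝓝 0) →
        (∀ j, Torus.IsGlobalLerayHopf (ν j) (fun _ => f) (u₀ j) (u j)) →
        (∀ j (t : ℝ) (s : UnitAddCircle) (x : UnitAddTorus (Fin 3)),
          u j t (x + Pi.single (2 : Fin 3) s) = u j t x) →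
        (∃ E : ℝ, ∀ j, meanEnergy (u j) ≤ E) →
        (∃ ε : ℝ, 0 < ε ∧ ∀ j, ε ≤ meanDissipation (ν j) (u j)) →
        ∃ c : ℝ, 0 < c ∧ ∀ᶠ j in atTop, c * Real.log (ν j)⁻¹ ≤
          longTimeAvgSup (fun t => Real.sqrt (Torus.eGradNormSq
            (fun y : UnitAddTorus (Fin 2) => Torus.planarProjE (u j t (Torus.planarSect y)))).toReal) := by
  intro hO1 f hfinv hfs hfd hfz ν u₀ u hν hν0 hLH huinv hE hfloor
  -- eventually `ν_j < 1`, so `log (1/ν_j) > 0`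
  have hlog : ∀ᶠ j in atTop, 0 < Real.log (ν j)⁻¹ := by
    filter_upwards [hν0.eventually (gt_mem_nhds one_pos)] with j hj
    exact Real.log_pos ((one_lt_inv₀ (hν j)).2 hj)
  -- the section strain mean is nonnegative; O1 on every subsequence witness forbids a vanishing ratio
  refine exists_pos_eventually_mul_le_of_forall_strictMono
    (a := fun j => longTimeAvgSup (fun t => Real.sqrt (Torus.eGradNormSq
      (fun y : UnitAddTorus (Fin 2) => Torus.planarProjE (u j t (Torus.planarSect y)))).toReal))
    (b := fun j => Real.log (ν j)⁻¹)
    (fun j => longTimeAvgSup_nonneg fun t => Real.sqrt_nonneg _) hlog fun φ hφ => ?_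
  exact hO1 f hfinv hfs hfd hfz (fun n => ν (φ n)) (fun n => u₀ (φ n)) (fun n => u (φ n))
    (fun n => hν (φ n)) (hν0.comp hφ.tendsto_atTop) (fun n => hLH (φ n)) (fun n => huinv (φ n))
    (hE.imp fun E hE' n => hE' (φ n)) (hfloor.imp fun ε hε' => ⟨hε'.1, fun n => hε'.2 (φ n)⟩)

end Summit.AnomalousDissipation.AnomalousDissipation.Theorems.TwohalfdThesis

end
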